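import Mathlib
import Literature.RingTheory.PBasis.KimuraNiitsuma1982
import Literature.RingTheory.Flat.FiniteRegularFree
import Literature.RingTheory.KrullDimension.AffineDimension
import Literature.AlgebraicGeometry.Resolution.RootAdjunctionRegular
import Literature.AlgebraicGeometry.Resolution.RegularLocalRingsQuotient
import Literature.RingTheory.DiscreteValuationRing.UnramifiedAdjoin
import HarnessLib

/-!
# Kunz's conjecture (Kimura–Niitsuma 1982, THEOREM of §3): the induction, reduced to their Lemma 5

Topic: `Literature/RingTheory/PBasis`. T. Kimura, H. Niitsuma, *On Kunz's conjecture*, J. Math. Soc. Japan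
**34** (1982) 371–378, doi:10.2969/jmsj/03420371 (held text `paper:kimura1982-kunz-s-conjecture`; PDF page =
file `p000N`; printed page = 370 + N). THEOREM (p. 375 l. 29–31): «Let `R` be a regular local ring of
characteristic `p > 0` and let `R'` be a regular subring of `R` such that `R'` contains `R^p` and such that `R`
is a finite `R'`-module. Then `R` has a `p`-basis over `R'`.» — the tree's named fact
`Literature.RingTheory.PBasis.KimuraNiitsuma1982_theorem` (F-96h, `KimuraNiitsuma1982.lean`).

This file PROVES (sorry-free, no new named fact) every step of the printed proof of the THEOREM except the
content of the paper's **Lemma 5** (p. 376 l. 15–18: «If `R'` is regular, then `𝔪' = 𝔪^{(p)}R'` or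
`𝔪' ⊄ 𝔪²`»), and assembles them into
`RelativePBasis.kimuraNiitsuma1982_theorem_of_lemma5 : (Lemma 5, in the form used on p. 377) → KimuraNiitsuma1982_theorem`.
Lemma 5 is the one non-elementary input of the paper: its printed proof goes through the FINITE case of the
theorem (p. 375–376: S. Yuan's inseparable Galois theory, Thm. 9 of [10], and Harper's theorem on
differentiably simple rings = Cor. 2.8 of [9]), then completion, Cohen's structure theorem and base change to
the algebraic closure of the residue field (p. 376 l. 19 – p. 377 l. 1); none of that is in the tree, and it is
NOT claimed here. `KimuraNiitsuma1982_theorem` itself therefore stays a named fact (undischarged).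

## The printed proof and what is proved here (namespace `Literature.RingTheory.PBasis.RelativePBasis`)

Standing data: `R ⊇ R' ⊇ R^p` with `R`, `R'` regular local of characteristic `p`, `R` module-finite over `R'`
(`hR' : (frobenius R p).range ≤ R'`).

* §1 of the paper / KN 1980 Lemma 2.1: `R'` is local with `𝔪' = 𝔪 ∩ R'`, `R' → R` is a local homomorphism,
  `R` is integral over `R'`, `dim R' = dim R`, `𝔪^N ⊆ 𝔪'R` — `isLocalRing`, `maximalIdeal_eq_comap`,
  `isIntegral`, `ringKrullDim_eq`, `exists_maximalIdeal_pow_le_map`;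
* «In view of Theorem 46 of [6], `R` is a finite free `R'`-module» (p. 375 l. −4) — `free`, from the tree's
  Matsumura 23.1 (`Literature.RingTheory.Flat.free_of_isRegularLocalRing_of_maximalIdeal_pow_le`);
* reduced monomials of a finite family `b : Fin s → R` with `bᵢ^p ∈ R'` and `R'[b] = R` SPAN `R`
  (`span_monomial_eq_top`), are independent as soon as `rank_{R'} R = p^s`
  (`linearIndependent_monomial_of_finrank_eq`, Orzech property), and give Kimura–Niitsuma's printed
  `IsPBasisOver p R' {b₁,…,b_s}` (`isPBasisOver_range`: any injective family drawn from `{bᵢ}` is `b ∘ σ`);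
* the ONE-STEP radicial extension (KN 1980 Lemmas 2.4–2.5; Nagata 38.4; used on p. 373–374 and p. 377):
  if `A = R'[X]/(X^p − c^p)` is regular local then `X ↦ c` is an isomorphism onto `R'' = R'[c]` — «`R_{r-s}` is
  normal and `R'` is integral over it, hence equal» is replaced by the equivalent dimension count (a regular
  local DOMAIN of dimension `dim R` surjecting onto a subring of `R` over which `R` is integral) — so `R''` is
  regular local, `R ⊇ R'' ⊇ R' ⊇ R^p`, `1, c, …, c^{p−1}` are `R'`-independent and
  `rank_{R'} R = p · rank_{R''} R` (`oneStep`); `A` is regular local when `c^p ∈ 𝔪' ∖ 𝔪'²`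
  (`isRegularLocalRing_adjoinRoot_of_not_mem_sq`, tree `AdjoinRoot.isRegularLocalRing_X_pow_sub_C`) and when
  `c` is residually new, `c̄ ∉ k'` (`isRegularLocalRing_adjoinRoot_of_residue`: `X^p − c̄^p` is irreducible over
  `k'` by Kummer, so `𝔪_A = 𝔪'A` has `dim R'` generators) — the latter is the paper's reduction «we may assume
  `k = k'`» via `R'[B]` (p. 377 l. 5–7);
* SLICING (p. 377 l. 14–22): for `y ∈ R'` with `y ∈ 𝔪 ∖ 𝔪²`, `R/yR ⊇ R'/yR'` is again such a pair of dimension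
  `dim R − 1` («since `R` is faithfully flat over `R'`, `yR ∩ R' = yR'`»), and representatives of a `p`-basis
  of `R/yR` over `R'/yR'` form a `p`-basis of `R` over `R'` (Nakayama; rank count) — `slice`;
* ASSEMBLY (`kimuraNiitsuma1982_theorem_of_lemma5`): induction on `dim R + rank_{R'} R`; if `R' = R` take
  `Γ = ∅`; if some `c` is residually new, or some `z ∈ 𝔪` has `z^p ∉ 𝔪'²`, adjoin it (one step, then
  `adjoin_cons_eq_top`, `linearIndependent_monomial_cons`); if some `y ∈ R' ∩ 𝔪 ∖ 𝔪²` exists, slice; the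
  remaining case (`k' = k`, `𝔪' ⊆ 𝔪²`, all `z^p ∈ 𝔪'²`, `R' ≠ R`) is exactly what Lemma 5 excludes
  (`𝔪' ⊆ 𝔪² ⇒ 𝔪' = 𝔪^{(p)}R'`, and `𝔪^{(p)}R' ⊆ 𝔪'²` would force `𝔪' = 0`, `dim = 0`, `R = k = k' = R'`) —
  this is the hypothesis `h5`, stated in the tree's vocabulary.
* BOUNDED ASSEMBLY AND THE CASE `dim R ≤ 1` (revision 2, same seat): the induction only revisits the same `R`
  over a larger subring (rank divided by `p`) or a slice (`dim` drops by one, rank does not grow), so `h5` is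
  needed only for pairs with `dim ≤ D`, `rank ≤ F` when one starts there (`exists_isPBasisOver_of_lemma5_le`);
  in dimension `≤ 1` the Lemma-5 input IS proved here (`lemma5_of_ringKrullDim_le_one`: both rings are discrete
  valuation rings, a uniformizer of `R'` is `unit · ϖ^e` with `e ≥ 2`, and `ϖ^p = unit · π'^n` gives `p = e·n`,
  so `e = p` and `ϖ^p` is a uniformizer of `R'`), whence the THEOREM is UNCONDITIONAL for `dim R ≤ 1`
  (`exists_isPBasisOver_of_ringKrullDim_le_one`). What remains open in the tree for rank `p` and `dim R ≥ 2` is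
  exactly «rank `p`, `k = k'`, `𝔪' ⊆ 𝔪²` is impossible», i.e. Kunz's conjecture in rank `p` (for `dim R = 2`
  over `k = k̄` this is Ganong's theorem [cite: Ganong1982, Theorem p. 474, power-series case §2 p. 477], proved
  there with Hamburger–Noether expansions; KN prove it through Lemma 5).

Not a statement of H. Hironaka's manuscript; settled 1982 mathematics. Resolution of singularities in positive
characteristic is not proved by any of this. Written by seat `res-B-lit-kn82` (literature-prover) of cell
res-hironaka for the INPUTS desk (F-96h).

## References
* T. Kimura, H. Niitsuma, *On Kunz's conjecture*, J. Math. Soc. Japan 34 (1982) 371–378. [KimuraNiitsuma1982]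
* T. Kimura, H. Niitsuma, *Regular local ring of characteristic p and p-basis*, J. Math. Soc. Japan 32 (1980)
  363–371, Lemmas 2.1–2.6. [KimuraNiitsuma1980]
* H. Matsumura, *Commutative Ring Theory*, CUP 1986, Thms. 14.2, 23.1, §26 (p. 224: Harper's theorem and
  Kunz's conjecture). [Matsumura1987]
* R. Ganong, *Plane Frobenius sandwiches*, Proc. Amer. Math. Soc. 84 (1982) 474–478 (the rank-`p`, dimension-2
  case; context only, nothing of it is used). [Ganong1982]
-/

namespace Literature.RingTheory.PBasis

universe u

open IsLocalRing Module

namespace RelativePBasis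

variable {p : ℕ} [hp : Fact p.Prime] {R : Type u} [CommRing R] [CharP R p] {R' : Subring R}

/-- If `R' ⊇ R^p` then a unit of `R` lying in `R'` is a unit of `R'`: `x⁻¹ = x^{p-1} · (x⁻¹)^p` (KN 1980,
proof of Lemma 2.1: «`1/x = x^{p-1}(1/x)^p ∈ R'[A]`»). [cite: KimuraNiitsuma1980, Lemma 2.1 p. 365] -/
theorem isUnit_of_isUnit_coe (hR' : (frobenius R p).range ≤ R') {x : R'} (hx : IsUnit (x : R)) :
    IsUnit x := by
  obtain ⟨u, hu⟩ := hx
  have hinv : ((↑u⁻¹ : R) ^ p) ∈ R' := hR' ⟨(↑u⁻¹ : R), rfl⟩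
  refine ⟨⟨x, ⟨(x : R) ^ (p - 1) * (↑u⁻¹ : R) ^ p, R'.mul_mem (R'.pow_mem x.2 _) hinv⟩, ?_, ?_⟩, rfl⟩
  · apply Subtype.ext
    change (x : R) * ((x : R) ^ (p - 1) * (↑u⁻¹ : R) ^ p) = 1
    rw [← mul_assoc, ← pow_succ', Nat.sub_add_cancel hp.out.one_le, ← hu, ← mul_pow,
      Units.mul_inv, one_pow]
  · apply Subtype.ext
    change ((x : R) ^ (p - 1) * (↑u⁻¹ : R) ^ p) * (x : R) = 1
    rw [mul_comm, ← mul_assoc, ← pow_succ', Nat.sub_add_cancel hp.out.one_le, ← hu, ← mul_pow,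
      Units.mul_inv, one_pow]

/-- `R' ⊇ R^p` ⇒ the inclusion `R' → R` is a local homomorphism (units of `R` in `R'` are units of `R'`).
[cite: KimuraNiitsuma1980, Lemma 2.1 p. 365] -/
theorem isLocalHom_algebraMap (hR' : (frobenius R p).range ≤ R') :
    IsLocalHom (algebraMap R' R) :=
  ⟨fun _ hx => isUnit_of_isUnit_coe hR' hx⟩

variable [IsLocalRing R]

/-- `R' ⊇ R^p` inside a local ring `R` is local (KN 1980, Lemma 2.1). [cite: KimuraNiitsuma1980, Lemma 2.1] -/
theorem isLocalRing (hR' : (frobenius R p).range ≤ R') : IsLocalRing R' := by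
  haveI : Nontrivial R' := R'.subtype.domain_nontrivial
  refine IsLocalRing.of_isUnit_or_isUnit_one_sub_self fun x => ?_
  rcases IsLocalRing.isUnit_or_isUnit_one_sub_self (x : R) with h | h
  · exact Or.inl (isUnit_of_isUnit_coe hR' h)
  · exact Or.inr (isUnit_of_isUnit_coe hR' (by simpa using h))

/-- The maximal ideal of `R'` is `𝔪 ∩ R'`. [cite: KimuraNiitsuma1980, §1 p. 364] -/
theorem maximalIdeal_eq_comap (hR' : (frobenius R p).range ≤ R') :
    letI := isLocalRing hR'
    maximalIdeal R' = (maximalIdeal R).comap (algebraMap R' R) := by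
  letI := isLocalRing hR'
  haveI := isLocalHom_algebraMap hR'
  exact (IsLocalRing.maximalIdeal_comap (algebraMap R' R)).symm

/-- `x ∈ 𝔪'` iff `x ∈ 𝔪` («`𝔪 ∩ R' = 𝔪'`», KN 1982 §1 p. 372 l. 20). [cite: KimuraNiitsuma1982, §1 p. 372] -/
theorem mem_maximalIdeal_iff (hR' : (frobenius R p).range ≤ R') (x : R') :
    letI := isLocalRing hR'
    x ∈ maximalIdeal R' ↔ (x : R) ∈ maximalIdeal R := by
  letI := isLocalRing hR'
  rw [maximalIdeal_eq_comap hR', Ideal.mem_comap]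
  rfl

omit [IsLocalRing R] in
/-- `R` is integral over `R' ⊇ R^p` (every `x` is a root of `X^p - x^p`; used on p. 375 l. 2: «`R'` is integral
over `R_{r-s}`»). [cite: KimuraNiitsuma1982, proof of Lemma 2, p. 375 l. 2] -/
theorem isIntegral (hR' : (frobenius R p).range ≤ R') : Algebra.IsIntegral R' R := by
  refine ⟨fun x => ?_⟩
  have hx : x ^ p ∈ R' := hR' ⟨x, rfl⟩
  refine ⟨Polynomial.X ^ p - Polynomial.C ⟨x ^ p, hx⟩, Polynomial.monic_X_pow_sub_C _ hp.out.ne_zero, ?_⟩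
  simp only [Polynomial.eval₂_sub, Polynomial.eval₂_X_pow, Polynomial.eval₂_C]
  exact sub_eq_zero.mpr rfl

omit [IsLocalRing R] in
/-- `dim R' = dim R` (integral extension, injective). [cite: Matsumura1987, Thm. 9.4] -/
theorem ringKrullDim_eq (hR' : (frobenius R p).range ≤ R') : ringKrullDim R' = ringKrullDim R :=
  haveI := isIntegral hR'
  Literature.RingTheory.KrullDimension.ringKrullDim_eq_of_isIntegral (R := R') (S := R)
    (fun _ _ h => Subtype.ext h)

variable [IsNoetherianRing R]

/-- `𝔪_R` is nilpotent modulo `𝔪_{R'} R`: `𝔪^N ⊆ 𝔪' R` for some `N` (each `x ∈ 𝔪` has `x^p ∈ 𝔪'`). [folklore] -/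
private theorem exists_maximalIdeal_pow_le_map (hR' : (frobenius R p).range ≤ R') :
    letI := isLocalRing hR'
    ∃ N : ℕ, maximalIdeal R ^ N ≤ (maximalIdeal R').map (algebraMap R' R) := by
  letI := isLocalRing hR'
  apply Ideal.exists_pow_le_of_le_radical_of_fg _ (IsNoetherian.noetherian _)
  intro x hx
  have hxp : x ^ p ∈ R' := hR' ⟨x, rfl⟩
  refine ⟨p, Ideal.mem_map_of_mem (algebraMap R' R) (x := ⟨x ^ p, hxp⟩) ?_⟩
  rw [mem_maximalIdeal_iff hR']
  exact Ideal.pow_mem_of_mem _ hx _ hp.out.pos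

end RelativePBasis

namespace RelativePBasis

variable {p : ℕ} [hp : Fact p.Prime] {R : Type u} [CommRing R] [CharP R p] {R' : Subring R}

/-- **Matsumura Thm 23.1 / KN 1982's use of [6] Thm 46**: for `R ⊇ R' ⊇ R^p` with `R`, `R'` regular local and
`R` finite over `R'`, `R` is a free `R'`-module. [cite: Matsumura1987, Thm. 23.1] -/
theorem free [IsRegularLocalRing R] (hR' : (frobenius R p).range ≤ R') (hreg : IsRegularLocalRing R')
    [Module.Finite R' R] : Module.Free R' R := by
  haveI := hreg
  haveI := isLocalHom_algebraMap hR'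
  exact Literature.RingTheory.Flat.free_of_isRegularLocalRing_of_maximalIdeal_pow_le
    (ringKrullDim_eq hR').symm (exists_maximalIdeal_pow_le_map hR')

end RelativePBasis

/-! ## Reduced monomials of a finite family: spanning, independence by counting, `IsPBasisOver` -/

namespace RelativePBasis

variable {p : ℕ} [hp : Fact p.Prime] {R : Type u} [CommRing R] {R' : Subring R}

/-- The reduced monomial `∏ bᵢ^{nᵢ}` (`0 ≤ nᵢ < p`) of a finite family `b₁, …, b_s` (KN 1980 p. 363 l. 7–10:
«`{b₁^{n₁} ⋯ b_s^{n_s} | 0 ≤ nᵢ < p}`»). [cite: KimuraNiitsuma1980, p. 363 l. 7–10] -/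
abbrev monomial (p : ℕ) {s : ℕ} (b : Fin s → R) (n : Fin s → Fin p) : R := ∏ i, b i ^ (n i : ℕ)

omit hp in
/-- `b^n = b_j^{n_j} · ∏_{i ≠ j} b_i^{n_i}`. [folklore] -/
private theorem monomial_eq_mul_prod_erase {s : ℕ} (b : Fin s → R) (n : Fin s → Fin p) (j : Fin s) :
    monomial p b n = b j ^ (n j : ℕ) * ∏ i ∈ Finset.univ.erase j, b i ^ (n i : ℕ) := by
  classical
  exact (Finset.mul_prod_erase Finset.univ (fun i => b i ^ ((n i : Fin p) : ℕ)) (Finset.mem_univ j)).symm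

omit hp in
/-- Changing the `j`-th exponent does not change the other factors. [folklore] -/
private theorem prod_erase_update {s : ℕ} (b : Fin s → R) (n : Fin s → Fin p) (j : Fin s) (m : Fin p) :
    ∏ i ∈ Finset.univ.erase j, b i ^ ((Function.update n j m i : Fin p) : ℕ) =
      ∏ i ∈ Finset.univ.erase j, b i ^ (n i : ℕ) := by
  classical
  exact Finset.prod_congr rfl fun i hi => by rw [Function.update_of_ne (Finset.ne_of_mem_erase hi)]

/-- **The reduced monomials span.** If `bᵢ^p ∈ R'` for all `i` and `R'[b₁, …, b_s] = R`, then the `p^s` reduced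
monomials span `R` as an `R'`-module (the span contains `1` and is stable under each `bⱼ`:
`bⱼ · b^n = b^{n+eⱼ}` if `nⱼ + 1 < p`, else `= bⱼ^p · b^{n - nⱼ eⱼ}`). [cite: KimuraNiitsuma1980, p. 363 l. 7–10] -/
theorem span_monomial_eq_top {s : ℕ} (b : Fin s → R) (hpow : ∀ i, b i ^ p ∈ R')
    (hadj : Algebra.adjoin R' (Set.range b) = ⊤) :
    Submodule.span R' (Set.range (monomial p b)) = ⊤ := by
  classical
  have hp' : p.Prime := hp.out
  set M := Submodule.span R' (Set.range (monomial p b)) with hM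
  have h1 : (1 : R) ∈ M := by
    have : monomial p b (fun _ => ⟨0, hp'.pos⟩) = 1 := by simp [monomial]
    rw [← this]
    exact Submodule.subset_span ⟨_, rfl⟩
  have hbmon : ∀ (j : Fin s) (n : Fin s → Fin p), b j * monomial p b n ∈ M := by
    intro j n
    by_cases hlt : (n j : ℕ) + 1 < p
    · -- `b_j · b^n = b^{n + e_j}`
      have e : b j * monomial p b n = monomial p b (Function.update n j ⟨(n j : ℕ) + 1, hlt⟩) := by
        rw [monomial_eq_mul_prod_erase b n j, monomial_eq_mul_prod_erase b _ j, prod_erase_update,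
          Function.update_self]
        change b j * (b j ^ (n j : ℕ) * _) = b j ^ ((n j : ℕ) + 1) * _
        ring
      rw [e]
      exact Submodule.subset_span ⟨_, rfl⟩
    · -- `n_j = p - 1`: `b_j · b^n = b_j^p · b^{n - n_j e_j}`
      have hnj : (n j : ℕ) = p - 1 := by have := (n j).2; omega
      have e : b j * monomial p b n = b j ^ p * monomial p b (Function.update n j ⟨0, hp'.pos⟩) := by
        rw [monomial_eq_mul_prod_erase b n j, monomial_eq_mul_prod_erase b _ j, prod_erase_update,
          Function.update_self, hnj]
        change b j * (b j ^ (p - 1) * _) = b j ^ p * (b j ^ (0 : ℕ) * _)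
        rw [pow_zero, one_mul, ← mul_assoc, ← pow_succ', Nat.sub_add_cancel hp'.one_le]
      rw [e]
      exact M.smul_mem (⟨b j ^ p, hpow j⟩ : R') (Submodule.subset_span ⟨_, rfl⟩)
  have hbM : ∀ (j : Fin s), ∀ v ∈ M, b j * v ∈ M := by
    intro j v hv
    refine Submodule.span_induction ?_ ?_ ?_ ?_ hv
    · rintro _ ⟨n, rfl⟩
      exact hbmon j n
    · rw [mul_zero]; exact M.zero_mem
    · intro x y _ _ hx hy
      rw [mul_add]; exact M.add_mem hx hy
    · intro c x _ hx
      rw [mul_smul_comm]; exact M.smul_mem c hx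
  have hall : ∀ r : R, ∀ v ∈ M, r * v ∈ M := by
    intro r
    have hr : r ∈ Algebra.adjoin R' (Set.range b) := by rw [hadj]; trivial
    refine Algebra.adjoin_induction ?_ ?_ ?_ ?_ hr
    · rintro _ ⟨j, rfl⟩ v hv
      exact hbM j v hv
    · intro c v hv
      rw [Algebra.algebraMap_eq_smul_one, smul_mul_assoc, one_mul]
      exact M.smul_mem c hv
    · intro x y _ _ hx hy v hv
      rw [add_mul]; exact M.add_mem (hx v hv) (hy v hv)
    · intro x y _ _ hx hy v hv
      rw [mul_assoc]; exact hx _ (hy v hv)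
  rw [eq_top_iff]
  intro f _
  simpa using hall f 1 h1

/-- **Independence by counting**: if moreover `R` is a free `R'`-module of rank `p^s`, the `p^s` spanning
reduced monomials are linearly independent (KN 1982 p. 376 l. 9–12: «since `R'` is a free `R^p`-module, every
minimal basis of `R'` is linearly independent over `R^p`. Hence `A` is a `p`-basis»; a commutative ring has the
Orzech property). [cite: KimuraNiitsuma1982, p. 376 l. 9–12] -/
theorem linearIndependent_monomial_of_finrank_eq [Nontrivial R] [Module.Finite R' R] {s : ℕ} (b : Fin s → R)
    (hpow : ∀ i, b i ^ p ∈ R') (hadj : Algebra.adjoin R' (Set.range b) = ⊤)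
    (hrank : Module.finrank R' R = p ^ s) : LinearIndependent R' (monomial p b) := by
  haveI : Nontrivial R' := R'.subtype.domain_nontrivial
  refine linearIndependent_of_top_le_span_of_card_eq_finrank
    (by rw [span_monomial_eq_top b hpow hadj]) ?_
  rw [hrank, Fintype.card_fun, Fintype.card_fin, Fintype.card_fin]

/-- If the reduced monomials of `b` are linearly independent and span, `finrank_{R'} R = p^s`. [folklore] -/
private theorem finrank_eq_of_linearIndependent_monomial [Nontrivial R] {s : ℕ} (b : Fin s → R)
    (hpow : ∀ i, b i ^ p ∈ R') (hadj : Algebra.adjoin R' (Set.range b) = ⊤)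
    (hli : LinearIndependent R' (monomial p b)) : Module.finrank R' R = p ^ s := by
  haveI : Nontrivial R' := R'.subtype.domain_nontrivial
  have hsp := span_monomial_eq_top b hpow hadj
  have B : Module.Basis (Fin s → Fin p) R' R := Module.Basis.mk hli (by rw [hsp])
  rw [Module.finrank_eq_card_basis B, Fintype.card_fun, Fintype.card_fin, Fintype.card_fin]

/-- **From one injective enumeration to Kimura–Niitsuma's `IsPBasisOver`.** If `b : Fin s → R` is injective,
`R'[b] = R` and the reduced monomials of `b` are independent, then `Γ = {b₁, …, b_s}` is a `p`-basis of `R`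
over `R'` in the printed sense (independence for EVERY finite injective family drawn from `Γ`: such a family
is `b ∘ σ` for an injection `σ`, and its reduced monomials are a subfamily of those of `b`).
[cite: KimuraNiitsuma1980, p. 363 l. 7–10] -/
theorem isPBasisOver_range {s : ℕ} {b : Fin s → R}
    (hadj : Algebra.adjoin R' (Set.range b) = ⊤) (hli : LinearIndependent R' (monomial p b)) :
    IsPBasisOver p R' (Set.range b) := by
  classical
  refine ⟨hadj, fun s' c hc hcΓ => ?_⟩
  -- `c = b ∘ σ` with `σ` injective
  choose σ hσ using hcΓ
  have hσinj : Function.Injective σ := fun i j h => hc (by rw [← hσ i, ← hσ j, h])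
  -- extension of an exponent vector on `Fin s'` to `Fin s` by zero
  have hp0 : 0 < p := hp.out.pos
  let ext : (Fin s' → Fin p) → (Fin s → Fin p) := fun n j =>
    if h : ∃ i, σ i = j then n h.choose else ⟨0, hp0⟩
  have hext_apply : ∀ (n : Fin s' → Fin p) (i : Fin s'), ext n (σ i) = n i := by
    intro n i
    have h : ∃ i', σ i' = σ i := ⟨i, rfl⟩
    simp only [ext, dif_pos h]
    congr 1
    exact hσinj h.choose_spec
  have hext_inj : Function.Injective ext := by
    intro n m h
    funext i
    rw [← hext_apply n i, ← hext_apply m i, h]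
  have hmono : (fun n : Fin s' → Fin p => ∏ i, c i ^ ((n i : ℕ))) = monomial p b ∘ ext := by
    funext n
    simp only [Function.comp_apply, monomial]
    -- split the product over `Fin s` into the image of `σ` and its complement (exponent `0` there)
    rw [← Finset.prod_subset (Finset.subset_univ (Finset.univ.image σ))]
    · rw [Finset.prod_image (fun i _ j _ h => hσinj h)]
      refine Finset.prod_congr rfl fun i _ => ?_
      rw [hσ i, hext_apply]
    · intro j _ hj
      have h : ¬ ∃ i, σ i = j := fun ⟨i, hi⟩ => hj (Finset.mem_image.mpr ⟨i, Finset.mem_univ _, hi⟩)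
      simp only [ext, dif_neg h, pow_zero]
  rw [hmono]
  exact hli.comp ext hext_inj

end RelativePBasis

/-! ## The one-step radicial extension `R'' = R'[c] ≅ R'[X]/(X^p − c^p)` (KN 1980 Lemma 2.4; Nagata 38.4) -/

namespace RelativePBasis

open Polynomial Literature.AlgebraicGeometry.Resolution

variable {p : ℕ} [hp : Fact p.Prime] {R : Type u} [CommRing R] [CharP R p] [IsRegularLocalRing R]
  {R' : Subring R}

/-- **One-step extension, core.** Let `R ⊇ R' ⊇ R^p` (`R`, `R'` regular local, `R` finite over `R'`), `c ∈ R`,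
`y = c^p ∈ R'`, and suppose `A = R'[X]/(X^p − y)` is a regular local ring. Then `X ↦ c` maps `A` ISOMORPHICALLY
onto `R'' = R'[c] ⊆ R` (a regular local domain of dimension `dim R'` surjecting onto a ring of the same dimension),
so `R''` is a regular local ring with `R^p ⊆ R' ⊆ R'' ⊆ R`, `R` is finite over `R''`, `1, c, …, c^{p−1}` are
`R'`-independent and `rank_{R'} R = p · rank_{R''} R`. [cite: KimuraNiitsuma1980, Lemma 2.4–2.5] -/
theorem oneStep (hR' : (frobenius R p).range ≤ R') (hreg : IsRegularLocalRing R') [Module.Finite R' R] (c : R)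
    (hregA : IsRegularLocalRing (AdjoinRoot (X ^ p - C (⟨c ^ p, hR' ⟨c, rfl⟩⟩ : R') : R'[X]))) :
    ∃ R'' : Subring R, R' ≤ R'' ∧ c ∈ R'' ∧ R'' = (Algebra.adjoin R' {c}).toSubring ∧
      (frobenius R p).range ≤ R'' ∧ IsRegularLocalRing R'' ∧ Module.Finite R'' R ∧
      LinearIndependent R' (fun j : Fin p => c ^ (j : ℕ)) ∧
      Module.finrank R' R = p * Module.finrank R'' R ∧ 0 < Module.finrank R'' R := by
  classical
  haveI := hreg
  have hp' : p.Prime := hp.out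
  haveI : IsDomain R' := isDomain_of_isRegularLocalRing R'
  haveI : IsDomain R := isDomain_of_isRegularLocalRing R
  set y : R' := ⟨c ^ p, hR' ⟨c, rfl⟩⟩ with hy
  set f : R'[X] := X ^ p - C y with hf
  have hmon : f.Monic := monic_X_pow_sub_C y hp'.ne_zero
  haveI : Module.Finite R' (AdjoinRoot f) := hmon.finite_adjoinRoot
  haveI : Module.Free R' (AdjoinRoot f) := hmon.free_adjoinRoot
  haveI : Algebra.IsIntegral R' (AdjoinRoot f) := inferInstance
  haveI := hregA
  haveI : IsDomain (AdjoinRoot f) := isDomain_of_isRegularLocalRing _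
  have hinjA : Function.Injective (algebraMap R' (AdjoinRoot f)) :=
    AdjoinRoot.of.injective_of_degree_ne_zero (by
      rw [hf, degree_X_pow_sub_C hp'.pos y]; exact_mod_cast hp'.ne_zero)
  -- the map `X ↦ c`
  have hroot : f.eval₂ (algebraMap R' R) c = 0 := by
    rw [hf, eval₂_sub, eval₂_X_pow, eval₂_C, sub_eq_zero]; rfl
  set φ : AdjoinRoot f →ₐ[R'] R := AdjoinRoot.liftAlgHom f (Algebra.ofId R' R) c hroot with hφ
  have hφof : ∀ r : R', φ (AdjoinRoot.of f r) = (r : R) := fun r => by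
    rw [hφ, AdjoinRoot.liftAlgHom_of]; rfl
  have hφroot : φ (AdjoinRoot.root f) = c := by rw [hφ, AdjoinRoot.liftAlgHom_root]
  set T : Subring R := φ.toRingHom.range with hT
  have hle : R' ≤ T := fun r hr => ⟨AdjoinRoot.of f ⟨r, hr⟩, hφof ⟨r, hr⟩⟩
  have hcT : c ∈ T := ⟨AdjoinRoot.root f, hφroot⟩
  have hfrobT : (frobenius R p).range ≤ T := hR'.trans hle
  -- dimensions
  obtain ⟨n, hn⟩ := exists_nat_cast_eq_ringKrullDim (R := R')
  have hdimR : ringKrullDim R = n := by rw [← ringKrullDim_eq hR', hn]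
  have hdimA : ringKrullDim (AdjoinRoot f) = n := by
    rw [← Literature.RingTheory.KrullDimension.ringKrullDim_eq_of_isIntegral hinjA, hn]
  have hdimT : ringKrullDim T = n := by rw [ringKrullDim_eq hfrobT, hdimR]
  -- `φ` is injective: its kernel is a prime of the `n`-dimensional domain `A` with `n`-dimensional quotient
  have hker : RingHom.ker φ.toRingHom = ⊥ := by
    by_contra hne
    obtain ⟨a, haK, ha0⟩ := Submodule.exists_mem_ne_zero_of_ne_bot hne
    have h1 := ringKrullDim_quotient_succ_le_of_nonZeroDivisor (mem_nonZeroDivisors_of_ne_zero ha0)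
    have hspan : Ideal.span {a} ≤ RingHom.ker φ.toRingHom := by
      rw [Ideal.span_le, Set.singleton_subset_iff]; exact haK
    have h2 : ringKrullDim (AdjoinRoot f ⧸ RingHom.ker φ.toRingHom) ≤
        ringKrullDim (AdjoinRoot f ⧸ Ideal.span {a}) :=
      ringKrullDim_le_of_surjective _ (Ideal.Quotient.factor_surjective hspan)
    have h3 : ringKrullDim (AdjoinRoot f ⧸ RingHom.ker φ.toRingHom) = n := by
      rw [ringKrullDim_eq_of_ringEquiv (RingHom.quotientKerEquivRange φ.toRingHom), ← hT, hdimT]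
    rw [hdimA] at h1
    rw [h3] at h2
    have h4 : (n : WithBot ℕ∞) + 1 ≤ n := (add_le_add h2 le_rfl).trans h1
    have h5 : ((n + 1 : ℕ) : WithBot ℕ∞) ≤ (n : ℕ) := by exact_mod_cast h4
    have h6 : n + 1 ≤ n := by exact_mod_cast h5
    omega
  have hinj : Function.Injective φ := (RingHom.injective_iff_ker_eq_bot φ.toRingHom).mpr hker
  -- `A ≃ T`
  let e : AdjoinRoot f ≃+* T := RingEquiv.ofBijective φ.toRingHom.rangeRestrict
    ⟨fun a b h => hinj (congrArg Subtype.val h), RingHom.rangeRestrict_surjective _⟩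
  have he : ∀ a, ((e a : T) : R) = φ a := fun a => rfl
  haveI hregT : IsRegularLocalRing T := IsRegularLocalRing.of_ringEquiv e
  -- `T = R'[c]`
  have hrange : φ.range = Algebra.adjoin R' {c} := by
    apply le_antisymm
    · rintro _ ⟨a, rfl⟩
      induction a using AdjoinRoot.induction_on with
      | ih g =>
        change φ (AdjoinRoot.mk f g) ∈ Algebra.adjoin R' {c}
        rw [hφ, AdjoinRoot.liftAlgHom_mk]
        change Polynomial.aeval c g ∈ _
        rw [Algebra.adjoin_singleton_eq_range_aeval]
        exact ⟨g, rfl⟩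
    · rw [Algebra.adjoin_le_iff, Set.singleton_subset_iff]
      exact ⟨AdjoinRoot.root f, hφroot⟩
  have hTadj : T = (Algebra.adjoin R' {c}).toSubring := by
    ext x
    rw [← hrange]
    change x ∈ φ.toRingHom.range ↔ x ∈ φ.range
    rw [RingHom.mem_range, AlgHom.mem_range]
    rfl
  -- algebra tower `R' → T → R`
  letI : Algebra R' T := (Subring.inclusion hle).toAlgebra
  haveI : IsScalarTower R' T R := IsScalarTower.of_algebraMap_eq (fun r => rfl)
  haveI : Module.Finite T R := Module.Finite.of_restrictScalars_finite R' T R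
  -- `T` is free of rank `p` over `R'`
  let eₗ : AdjoinRoot f ≃ₗ[R'] T :=
    { e with
      map_smul' := fun r a => by
        apply Subtype.ext
        change φ (r • a) = ((r : R') : R) * φ a
        rw [Algebra.smul_def, map_mul]
        congr 1
        exact hφof r }
  haveI : Module.Free R' T := Module.Free.of_equiv eₗ
  have hrankT : Module.finrank R' T = p := by
    rw [← eₗ.finrank_eq, (AdjoinRoot.powerBasis' hmon).finrank, AdjoinRoot.powerBasis'_dim, hf,
      natDegree_X_pow_sub_C]
  haveI : Module.Free T R := free hfrobT hregT
  have htower := Module.finrank_mul_finrank R' T R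
  rw [hrankT] at htower
  have hpos : 0 < Module.finrank T R := (Module.finrank_pos_iff_of_free T R).mpr inferInstance
  -- independence of `1, c, …, c^{p-1}` over `R'`
  have hli : LinearIndependent R' (fun j : Fin p => c ^ (j : ℕ)) := by
    have hnat : f.natDegree = p := by rw [hf, natDegree_X_pow_sub_C]
    have h0 := (AdjoinRoot.powerBasis' hmon).basis.linearIndependent
    have h1 : LinearIndependent R'
        (fun i : Fin f.natDegree => φ ((AdjoinRoot.powerBasis' hmon).basis i)) :=
      h0.map' φ.toLinearMap (LinearMap.ker_eq_bot.mpr hinj)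
    have h2 : ∀ i : Fin f.natDegree, φ ((AdjoinRoot.powerBasis' hmon).basis i) = c ^ (i : ℕ) := by
      intro i
      rw [PowerBasis.coe_basis, AdjoinRoot.powerBasis'_gen, map_pow, hφroot]
    simp_rw [h2] at h1
    have h3 : LinearIndependent R' ((fun j : Fin p => c ^ (j : ℕ)) ∘ finCongr hnat) := h1
    exact (linearIndependent_equiv (finCongr hnat)).mp h3
  exact ⟨T, hle, hcT, hTadj, hfrobT, hregT, inferInstance, hli, htower.symm, hpos⟩

omit [IsRegularLocalRing R] in
/-- **Case (ii): `y = c^p ∈ 𝔪' ∖ 𝔪'²`.** Then `𝔪' = (y, x₁, …, x_{m})` with `dim R' = m + 1` and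
`R'[X]/(X^p − y)` is regular local with maximal ideal `(X, x₁, …, x_m)` (tree
`AdjoinRoot.isRegularLocalRing_X_pow_sub_C`; Nagata, *Local Rings*, 38.4). [cite: Matsumura1987, Thm. 14.2] -/
theorem isRegularLocalRing_adjoinRoot_of_not_mem_sq (hR' : (frobenius R p).range ≤ R')
    (hreg : IsRegularLocalRing R') (c : R) (hy1 : (⟨c ^ p, hR' ⟨c, rfl⟩⟩ : R') ∈ maximalIdeal R')
    (hy2 : (⟨c ^ p, hR' ⟨c, rfl⟩⟩ : R') ∉ maximalIdeal R' ^ 2) :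
    IsRegularLocalRing (AdjoinRoot (X ^ p - C (⟨c ^ p, hR' ⟨c, rfl⟩⟩ : R') : R'[X])) := by
  classical
  haveI := hreg
  set y : R' := ⟨c ^ p, hR' ⟨c, rfl⟩⟩ with hy
  obtain ⟨s, hsfin, hscard, hspan⟩ := exists_span_insert_eq_maximalIdeal hy1 hy2
  have hreg' := (isRegularLocalRing_iff R').mp hreg
  -- `s.ncard + 1 = μ(𝔪') = dim R'`
  have hle : (maximalIdeal R').spanFinrank ≤ s.ncard + 1 := by
    rw [← hspan]
    exact (Submodule.spanFinrank_span_le_ncard_of_finite (hsfin.insert y)).trans (Set.ncard_insert_le y s)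
  have hcard : s.ncard + 1 = (maximalIdeal R').spanFinrank := le_antisymm hscard hle
  haveI := hsfin.fintype
  have hcard' : Fintype.card s = s.ncard := by rw [Set.ncard_eq_toFinset_card', Set.toFinset_card]
  let e := Fintype.equivFinOfCardEq hcard'
  let x : Fin s.ncard → R' := fun i => ((e.symm i : s) : R')
  have hx : Set.range x = s := by
    ext r
    constructor
    · rintro ⟨i, rfl⟩; exact (e.symm i).2
    · intro hr; exact ⟨e ⟨r, hr⟩, by simp [x]⟩
  have hgen : Ideal.span (insert y (Set.range x)) = maximalIdeal R' := by rw [hx, hspan]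
  have hdim : ringKrullDim R' = (s.ncard : ℕ) + 1 := by
    rw [← hreg', ← hcard]; push_cast; rfl
  obtain ⟨_, hregA, -⟩ := AdjoinRoot.isRegularLocalRing_X_pow_sub_C x y hgen hdim hp.out.pos
  exact hregA

/-- **Case (i): `c` residually new** (`c̄ ∉ k'`). Then `X^p − \\bar y` is irreducible over `k'` (Kummer: `\\bar y` is not a
`p`-th power in `k'`), so `A = R'[X]/(X^p − y)` is local with maximal ideal `𝔪' A`, generated by `dim R' = dim A`
elements: `A` is regular local. [cite: KimuraNiitsuma1980, Lemma 2.4] -/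
theorem isRegularLocalRing_adjoinRoot_of_residue (hR' : (frobenius R p).range ≤ R')
    (hreg : IsRegularLocalRing R') (c : R) (hc : ∀ b : R', c - b ∉ maximalIdeal R) :
    IsRegularLocalRing (AdjoinRoot (X ^ p - C (⟨c ^ p, hR' ⟨c, rfl⟩⟩ : R') : R'[X])) := by
  classical
  haveI := hreg
  have hp' : p.Prime := hp.out
  haveI : IsDomain R' := isDomain_of_isRegularLocalRing R'
  set y : R' := ⟨c ^ p, hR' ⟨c, rfl⟩⟩ with hy
  set f : R'[X] := X ^ p - C y with hf
  have hmon : f.Monic := monic_X_pow_sub_C y hp'.ne_zero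
  haveI : Module.Finite R' (AdjoinRoot f) := hmon.finite_adjoinRoot
  haveI : Module.Free R' (AdjoinRoot f) := hmon.free_adjoinRoot
  haveI : Algebra.IsIntegral R' (AdjoinRoot f) := inferInstance
  -- irreducibility of `X^p - ȳ` over `k'`
  have hirr : Irreducible (f.map (residue R')) := by
    have hfm : f.map (residue R') = X ^ p - C (residue R' y) := by
      rw [hf, Polynomial.map_sub, Polynomial.map_pow, map_X, map_C]
    rw [hfm]
    refine X_pow_sub_C_irreducible_of_prime hp' fun b hb => ?_
    obtain ⟨b, rfl⟩ := residue_surjective b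
    rw [← map_pow, ← sub_eq_zero, ← map_sub, residue_eq_zero_iff, mem_maximalIdeal_iff hR'] at hb
    apply hc b
    have hb' : ((b : R) - c) ^ p ∈ maximalIdeal R := by
      rw [sub_pow_char]; exact hb
    rw [← neg_sub]
    exact (maximalIdeal R).neg_mem ((maximalIdeal.isMaximal R).isPrime.mem_of_pow_mem p hb')
  haveI hloc := Literature.RingTheory.DiscreteValuationRing.isLocalRing_adjoinRoot_of_irreducible_map f hmon hirr
  have hmax := Literature.RingTheory.DiscreteValuationRing.maximalIdeal_adjoinRoot_eq_map f hmon hirr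
  -- `μ(𝔪_A) ≤ μ(𝔪') = dim R' = dim A`
  have hinjA : Function.Injective (algebraMap R' (AdjoinRoot f)) :=
    AdjoinRoot.of.injective_of_degree_ne_zero (by
      rw [hf, degree_X_pow_sub_C hp'.pos y]; exact_mod_cast hp'.ne_zero)
  have hdimA : ringKrullDim (AdjoinRoot f) = ringKrullDim R' :=
    (Literature.RingTheory.KrullDimension.ringKrullDim_eq_of_isIntegral hinjA).symm
  have fg' := (maximalIdeal R').fg_of_isNoetherianRing
  have hfin := Submodule.FG.finite_generators fg'
  have hspanA : maximalIdeal (AdjoinRoot f) =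
      Ideal.span ((AdjoinRoot.of f) '' (maximalIdeal R').generators) := by
    rw [hmax, ← Ideal.map_span]
    congr 1
    exact ((maximalIdeal R').span_generators).symm
  refine IsRegularLocalRing.of_spanFinrank_maximalIdeal_le _ ?_
  rw [hdimA, ← (isRegularLocalRing_iff R').mp hreg, Nat.cast_le, hspanA, ← Submodule.FG.generators_ncard fg']
  exact (Submodule.spanFinrank_span_le_ncard_of_finite (hfin.image _)).trans (Set.ncard_image_le hfin)

end RelativePBasis

/-! ## Slicing by `y ∈ 𝔪' ∖ 𝔪²` and lifting a `p`-basis (KN 1982, p. 377, end of the proof) -/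

namespace RelativePBasis

open Polynomial Literature.AlgebraicGeometry.Resolution

variable {p : ℕ} [hp : Fact p.Prime] {R : Type u} [CommRing R]

/-- A proper quotient of a ring of prime characteristic `p` has characteristic `p`. [folklore] -/
private theorem charP_quotient_of_ne_top [CharP R p] (I : Ideal R) (hI : I ≠ ⊤) : CharP (R ⧸ I) p :=
  CharP.quotient' p I fun x hx => by
    by_contra h
    have hndvd : ¬ p ∣ x := fun hd => h ((CharP.cast_eq_zero_iff R p x).mpr hd)
    exact hI (I.eq_top_of_isUnit_mem hx ((CharP.isUnit_natCast_iff hp.out).mpr hndvd))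

variable [CharP R p] [IsRegularLocalRing R] {R' : Subring R}

/-- **Slicing.** Let `R ⊇ R' ⊇ R^p` (`R`, `R'` regular local, `R` finite over `R'`) and `y ∈ R'` with
`y ∈ 𝔪_R ∖ 𝔪_R²`. Then `R̄ = R/yR ⊇ R̄' = R'/yR'` (the image of `R'`; `yR ∩ R' = yR'` by faithful flatness)
is again such a pair: both regular local of dimension `dim R - 1`, `R̄^p ⊆ R̄'`, `R̄` finite over `R̄'`; and a
finite family of `R` whose reduced monomials reduce to an `R̄'`-basis of `R̄` has `R'`-independent spanning reduced
monomials (Nakayama + rank count). [cite: KimuraNiitsuma1982, Theorem §3, proof p. 377] -/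
theorem slice (hR' : (frobenius R p).range ≤ R') (hreg : IsRegularLocalRing R') [Module.Finite R' R]
    {y : R} (hyR' : y ∈ R') (hym : y ∈ maximalIdeal R) (hym2 : y ∉ maximalIdeal R ^ 2) :
    ∃ (_ : CharP (R ⧸ Ideal.span {y}) p) (_ : IsRegularLocalRing (R ⧸ Ideal.span {y}))
      (Rb' : Subring (R ⧸ Ideal.span {y})),
      ringKrullDim (R ⧸ Ideal.span {y}) + 1 = ringKrullDim R ∧
      (frobenius (R ⧸ Ideal.span {y}) p).range ≤ Rb' ∧ IsRegularLocalRing Rb' ∧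
      Module.Finite Rb' (R ⧸ Ideal.span {y}) ∧
      (∀ x : R', Ideal.Quotient.mk (Ideal.span {y}) (x : R) ∈ Rb') ∧
      Module.finrank Rb' (R ⧸ Ideal.span {y}) ≤ Module.finrank R' R ∧
      (∀ (s : ℕ) (b : Fin s → R),
        Algebra.adjoin Rb' (Set.range (Ideal.Quotient.mk (Ideal.span {y}) ∘ b)) = ⊤ →
        LinearIndependent Rb' (monomial p (Ideal.Quotient.mk (Ideal.span {y}) ∘ b)) →
        Algebra.adjoin R' (Set.range b) = ⊤ ∧ LinearIndependent R' (monomial p b)) := by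
  classical
  haveI := hreg
  have hp' : p.Prime := hp.out
  haveI : IsDomain R := isDomain_of_isRegularLocalRing R
  haveI := isLocalHom_algebraMap hR'
  set I : Ideal R := Ideal.span {y} with hI
  have hIne : I ≠ ⊤ := fun h => (maximalIdeal.isMaximal R).ne_top
    (top_le_iff.mp (h ▸ (Ideal.span_singleton_le_iff_mem _).mpr hym))
  haveI : Nontrivial (R ⧸ I) := Ideal.Quotient.nontrivial_iff.mpr hIne
  haveI hchar : CharP (R ⧸ I) p := charP_quotient_of_ne_top I hIne
  obtain ⟨hregb, hdimb⟩ := IsRegularLocalRing.quotient_span_singleton hym hym2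
  haveI := hregb
  haveI : Module.Free R' R := free hR' hreg
  -- the image `R̄'` of `R'`
  set ψ : R' →+* R ⧸ I := algebraMap R' (R ⧸ I) with hψ
  have hψ_apply : ∀ r : R', ψ r = Ideal.Quotient.mk I (r : R) := fun r => rfl
  set Rb' : Subring (R ⧸ I) := ψ.range with hRb'
  letI : Algebra R' Rb' := ψ.rangeRestrict.toAlgebra
  haveI : IsScalarTower R' Rb' (R ⧸ I) := IsScalarTower.of_algebraMap_eq (fun r => rfl)
  have hsurj : Function.Surjective (algebraMap R' Rb') := ψ.rangeRestrict_surjective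
  -- `R̄^p ⊆ R̄'`
  have hfrob : (frobenius (R ⧸ I) p).range ≤ Rb' := by
    rintro _ ⟨x, rfl⟩
    obtain ⟨x, rfl⟩ := Ideal.Quotient.mk_surjective x
    refine RingHom.mem_range.mpr ⟨⟨x ^ p, hR' ⟨x, rfl⟩⟩, ?_⟩
    show Ideal.Quotient.mk I (x ^ p) = (frobenius (R ⧸ I) p) (Ideal.Quotient.mk I x)
    rw [frobenius_def, map_pow]
  -- `R̄'` is regular: `R̄' ≅ R'/yR'` since `yR ∩ R' = yR'`
  set y' : R' := ⟨y, hyR'⟩ with hy'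
  have hmapI : (Ideal.span {y'}).map (algebraMap R' R) = I := by
    rw [Ideal.map_span, Set.image_singleton]; rfl
  have hker : RingHom.ker ψ = Ideal.span {y'} := by
    ext r
    rw [RingHom.mem_ker, hψ_apply, Ideal.Quotient.eq_zero_iff_mem, ← hmapI]
    change algebraMap R' R r ∈ _ ↔ _
    rw [← Ideal.mem_comap, Ideal.comap_map_eq_self_of_faithfullyFlat]
  have hy'm : y' ∈ maximalIdeal R' := (mem_maximalIdeal_iff hR' y').mpr hym
  have hy'm2 : y' ∉ maximalIdeal R' ^ 2 := by
    intro h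
    apply hym2
    have : algebraMap R' R y' ∈ (maximalIdeal R' ^ 2).map (algebraMap R' R) := Ideal.mem_map_of_mem _ h
    rw [Ideal.map_pow] at this
    exact Ideal.pow_right_mono (IsLocalRing.map_maximalIdeal_le (algebraMap R' R)) 2 this
  obtain ⟨hreg'q, -⟩ := IsRegularLocalRing.quotient_span_singleton hy'm hy'm2
  have eq : (R' ⧸ Ideal.span {y'}) ≃+* Rb' :=
    (Ideal.quotEquivOfEq hker.symm).trans (RingHom.quotientKerEquivRange ψ)
  haveI hregRb' : IsRegularLocalRing Rb' := IsRegularLocalRing.of_ringEquiv eq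
  -- `R̄` finite over `R̄'`
  set π : R →ₗ[R'] R ⧸ I := (Ideal.Quotient.mkₐ R' I).toLinearMap with hπ
  have hπ_apply : ∀ x, π x = Ideal.Quotient.mk I x := fun x => rfl
  have hπsurj : Function.Surjective π := Ideal.Quotient.mk_surjective
  haveI : Module.Finite R' (R ⧸ I) := Module.Finite.of_surjective π hπsurj
  haveI hfin : Module.Finite Rb' (R ⧸ I) := Module.Finite.of_restrictScalars_finite R' Rb' (R ⧸ I)
  haveI : Module.Free Rb' (R ⧸ I) := free hfrob hregRb'
  haveI : Nontrivial R' := R'.subtype.domain_nontrivial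
  haveI : Nontrivial Rb' := Rb'.subtype.domain_nontrivial
  -- transport of spans along `π`: `span_{R̄'} (π '' S) = ⊤ ↔ span_{R'} S + yR = R`
  have key : ∀ S : Set R, Submodule.span R' S ⊔ (Ideal.span {y'} • ⊤ : Submodule R' R) = ⊤ →
      Submodule.span Rb' (π '' S) = ⊤ := by
    intro S hS
    have h1 : Submodule.restrictScalars R' (Submodule.span Rb' (π '' S)) = Submodule.span R' (π '' S) :=
      Submodule.restrictScalars_span R' Rb' hsurj _
    have h2 : Submodule.span R' (π '' S) = ⊤ := by
      rw [← Submodule.map_span, eq_top_iff]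
      rintro x -
      obtain ⟨x, rfl⟩ := hπsurj x
      have hx : x ∈ Submodule.span R' S ⊔ (Ideal.span {y'} • ⊤ : Submodule R' R) := by
        rw [hS]; exact Submodule.mem_top
      obtain ⟨m, hm, z, hz, rfl⟩ := Submodule.mem_sup.mp hx
      rw [map_add]
      have hz0 : π z = 0 := by
        rw [hπ_apply, Ideal.Quotient.eq_zero_iff_mem, ← hmapI]
        have hz' : z ∈ Submodule.restrictScalars R' ((Ideal.span {y'}).map (algebraMap R' R)) := by
          rw [← Ideal.smul_top_eq_map]; exact hz
        exact hz'
      rw [hz0, add_zero]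
      exact Submodule.mem_map_of_mem hm
    have h3 := h1.trans h2
    rwa [Submodule.restrictScalars_eq_top_iff] at h3
  -- a basis of `R` over `R'` reduces to a spanning family of `R̄` over `R̄'`: `rank R̄ ≤ rank R`
  have hrank_le' : Module.finrank Rb' (R ⧸ I) ≤ Module.finrank R' R := by
    let B := Module.Free.chooseBasis R' R
    have hBspan : Submodule.span Rb' (Set.range (π ∘ B)) = ⊤ := by
      rw [Set.range_comp]
      apply key
      rw [B.span_eq]; exact le_antisymm le_top le_sup_left
    rw [Module.finrank_eq_card_basis B]
    exact finrank_le_of_span_eq_top hBspan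
  refine ⟨hchar, hregb, Rb', hdimb, hfrob, hregRb', hfin, fun x => RingHom.mem_range.mpr ⟨x, rfl⟩,
    hrank_le', fun s b hadj hli => ?_⟩
  -- the lifting statement
  have hpowb : ∀ i, (Ideal.Quotient.mk I ∘ b) i ^ p ∈ Rb' := fun i => hfrob ⟨_, rfl⟩
  have hpow : ∀ i, b i ^ p ∈ R' := fun i => hR' ⟨_, rfl⟩
  have hspanb := span_monomial_eq_top (Ideal.Quotient.mk I ∘ b) hpowb hadj
  have hmono : Set.range (monomial p (Ideal.Quotient.mk I ∘ b)) = π '' Set.range (monomial p b) := by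
    ext x
    simp only [Set.mem_range, Set.mem_image, exists_exists_eq_and, hπ_apply, monomial, map_prod, map_pow,
      Function.comp_apply]
  -- (1) the lifted monomials span `R` (Nakayama)
  set M := Submodule.span R' (Set.range (monomial p b)) with hM
  have hsup : ⊤ ≤ M ⊔ (Ideal.span {y'} • ⊤ : Submodule R' R) := by
    rintro x -
    have hx : π x ∈ Submodule.span Rb' (π '' Set.range (monomial p b)) := by
      rw [← hmono, hspanb]; exact Submodule.mem_top
    have hx' : π x ∈ (Submodule.span R' (π '' Set.range (monomial p b))) := by
      rw [← Submodule.restrictScalars_span R' Rb' hsurj]; exact hx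
    rw [← Submodule.map_span] at hx'
    obtain ⟨m, hm, hmx⟩ := hx'
    have hxm : x - m ∈ I := by
      rw [← Ideal.Quotient.eq, ← hπ_apply, ← hπ_apply, hmx]
    rw [hI, Ideal.mem_span_singleton'] at hxm
    obtain ⟨r, hr⟩ := hxm
    have : x = m + r * y := by rw [hr]; ring
    rw [this]
    refine Submodule.add_mem_sup hm ?_
    rw [show r * y = y' • r from by rw [Algebra.smul_def, mul_comm]; rfl]
    exact Submodule.smul_mem_smul (Ideal.mem_span_singleton_self y') Submodule.mem_top
  have hjac : Ideal.span {y'} ≤ (⊥ : Ideal R').jacobson := by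
    rw [IsLocalRing.jacobson_eq_maximalIdeal ⊥ bot_ne_top, Ideal.span_le, Set.singleton_subset_iff]
    exact hy'm
  have hMtop : M = ⊤ := by
    refine le_antisymm le_top ?_
    exact Submodule.le_of_le_smul_of_le_jacobson_bot (Module.finite_def.mp inferInstance) hjac hsup
  -- (2) rank count: `finrank_{R'} R = p^s`
  have hcard : Fintype.card (Fin s → Fin p) = p ^ s := by
    rw [Fintype.card_fun, Fintype.card_fin, Fintype.card_fin]
  have hrank_le : Module.finrank R' R ≤ p ^ s := hcard ▸ finrank_le_of_span_eq_top hMtop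
  have hrankb : Module.finrank Rb' (R ⧸ I) = p ^ s :=
    finrank_eq_of_linearIndependent_monomial _ hpowb hadj hli
  have hrank_ge : p ^ s ≤ Module.finrank R' R := hrankb ▸ hrank_le'
  have hrank : Module.finrank R' R = p ^ s := le_antisymm hrank_le hrank_ge
  -- (3) conclusion
  have hadjR : Algebra.adjoin R' (Set.range b) = ⊤ := by
    -- the `R'`-span of the monomials is contained in `R'[b]`
    have hle : M ≤ Subalgebra.toSubmodule (Algebra.adjoin R' (Set.range b)) := by
      rw [hM, Submodule.span_le]
      rintro _ ⟨n, rfl⟩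
      exact Subalgebra.prod_mem _ fun i _ =>
        Subalgebra.pow_mem _ (Algebra.subset_adjoin (Set.mem_range_self i)) _
    rw [eq_top_iff]
    intro x _
    have hx : x ∈ M := by rw [hMtop]; exact Submodule.mem_top
    exact hle hx
  exact ⟨hadjR, linearIndependent_monomial_of_finrank_eq b hpow hadjR hrank⟩

end RelativePBasis

/-! ## Assembly: one-step + cons, and the induction -/

namespace RelativePBasis

open Polynomial Literature.AlgebraicGeometry.Resolution

variable {p : ℕ} [hp : Fact p.Prime] {R : Type u} [CommRing R] {R' : Subring R}

omit hp in
/-- `R'[c, b₁, …, b_s] = R` if `R''[b] = R` for `R'' = R'[c]` (towers of `p`-bases: KN 1982, proof of Cor. 1,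
p. 377: «the union of these two `p`-basis is a `p`-basis»). [cite: KimuraNiitsuma1982, proof of Corollary 1 p. 377] -/
theorem adjoin_cons_eq_top {R'' : Subring R} {c : R} (hR'' : R'' = (Algebra.adjoin R' {c}).toSubring)
    {s : ℕ} {b : Fin s → R} (hadj : Algebra.adjoin R'' (Set.range b) = ⊤) :
    Algebra.adjoin R' (Set.range (Fin.cons c b : Fin (s + 1) → R)) = ⊤ := by
  set S := Algebra.adjoin R' (Set.range (Fin.cons c b : Fin (s + 1) → R)) with hS
  have hc0 : c ∈ Set.range (Fin.cons c b : Fin (s + 1) → R) := ⟨0, by simp⟩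
  have hR''S : ∀ r : R'', (r : R) ∈ S := by
    intro r
    have hr : (r : R) ∈ (Algebra.adjoin R' {c}).toSubring := hR'' ▸ r.2
    exact Algebra.adjoin_mono (Set.singleton_subset_iff.mpr hc0) hr
  have hbS : ∀ i, b i ∈ S := fun i => Algebra.subset_adjoin ⟨i.succ, by simp⟩
  rw [eq_top_iff]
  intro x _
  have hx : x ∈ Algebra.adjoin R'' (Set.range b) := by rw [hadj]; trivial
  refine Algebra.adjoin_induction ?_ ?_ ?_ ?_ hx
  · rintro _ ⟨i, rfl⟩; exact hbS i
  · intro r; exact hR''S r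
  · intro x y _ _ hx hy; exact S.add_mem hx hy
  · intro x y _ _ hx hy; exact S.mul_mem hx hy

omit hp in
/-- Reduced monomials of `(c, b₁, …, b_s)` are `R'`-independent if those of `b` are `R''`-independent
(`R' ⊆ R'' ∋ c`) and `1, c, …, c^{p-1}` are `R'`-independent: regroup `Σ_n a_n c^{n₀} b^{n'}` as
`Σ_{n'} (Σ_j a_{j,n'} c^j) b^{n'}` (towers of `p`-bases: KN 1982, proof of Cor. 1, p. 377).
[cite: KimuraNiitsuma1982, proof of Corollary 1 p. 377] -/
theorem linearIndependent_monomial_cons {R'' : Subring R} (hle : R' ≤ R'') {c : R} (hc : c ∈ R'')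
    (hli_c : LinearIndependent R' (fun j : Fin p => c ^ (j : ℕ))) {s : ℕ} {b : Fin s → R}
    (hli_b : LinearIndependent R'' (monomial p b)) :
    LinearIndependent R' (monomial p (Fin.cons c b : Fin (s + 1) → R)) := by
  classical
  rw [Fintype.linearIndependent_iff]
  intro g hg
  have hmono : ∀ n : Fin (s + 1) → Fin p,
      monomial p (Fin.cons c b : Fin (s + 1) → R) n = c ^ (n 0 : ℕ) * monomial p b (Fin.tail n) := by
    intro n
    simp only [monomial, Fin.prod_univ_succ, Fin.cons_zero, Fin.cons_succ, Fin.tail]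
  -- coefficients in `R''`
  have hmem : ∀ m : Fin s → Fin p, (∑ j : Fin p, ((g (Fin.cons j m) : R') : R) * c ^ (j : ℕ)) ∈ R'' :=
    fun m => R''.sum_mem fun j _ => R''.mul_mem (hle (g _).2) (R''.pow_mem hc _)
  let α : (Fin s → Fin p) → R'' := fun m => ⟨_, hmem m⟩
  have hsum : ∑ m, α m • monomial p b m = 0 := by
    rw [← hg]
    symm
    calc ∑ n, g n • monomial p (Fin.cons c b : Fin (s + 1) → R) n
        = ∑ x : Fin p × (Fin s → Fin p), g (Fin.cons x.1 x.2) •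
            monomial p (Fin.cons c b : Fin (s + 1) → R) (Fin.cons x.1 x.2) := by
          refine Fintype.sum_equiv (Fin.consEquiv fun _ : Fin (s + 1) => Fin p).symm _ _ fun n => ?_
          simp only [Fin.consEquiv_symm_apply, Fin.cons_self_tail]
      _ = ∑ j : Fin p, ∑ m : Fin s → Fin p, g (Fin.cons j m) •
            monomial p (Fin.cons c b : Fin (s + 1) → R) (Fin.cons j m) := Fintype.sum_prod_type _
      _ = ∑ m : Fin s → Fin p, ∑ j : Fin p, g (Fin.cons j m) •
            monomial p (Fin.cons c b : Fin (s + 1) → R) (Fin.cons j m) := Finset.sum_comm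
      _ = ∑ m, α m • monomial p b m := by
          refine Finset.sum_congr rfl fun m _ => ?_
          change _ = (∑ j : Fin p, ((g (Fin.cons j m) : R') : R) * c ^ (j : ℕ)) * monomial p b m
          rw [Finset.sum_mul]
          refine Finset.sum_congr rfl fun j _ => ?_
          rw [hmono, Fin.cons_zero, Fin.tail_cons, Algebra.smul_def, mul_assoc]
          rfl
  have hα := (Fintype.linearIndependent_iff.mp hli_b) α hsum
  have hg' : ∀ (m : Fin s → Fin p) (j : Fin p), g (Fin.cons j m) = 0 := by
    intro m
    have h0 : ∑ j : Fin p, g (Fin.cons j m) • c ^ (j : ℕ) = 0 := by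
      have h1 := congrArg Subtype.val (hα m)
      change (∑ j : Fin p, ((g (Fin.cons j m) : R') : R) * c ^ (j : ℕ)) = 0 at h1
      simpa only [Subring.smul_def, smul_eq_mul] using h1
    exact (Fintype.linearIndependent_iff.mp hli_c) _ h0
  intro n
  rw [← Fin.cons_self_tail n]
  exact hg' _ _

/-- **Kimura–Niitsuma 1982, THEOREM of §3, from the content of their Lemma 5.** The hypothesis `h5` is the
consequence of KN 1982 Lemma 5 (p. 376: «if `R'` is regular, then `𝔪' = 𝔪^{(p)}R'` or `𝔪' ⊄ 𝔪²`») used on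
p. 377: for a pair `R ⊋ R' ⊇ R^p` as in the theorem with the same residue field and `𝔪' ⊆ 𝔪²`, some
`z ∈ 𝔪` has `z^p ∉ 𝔪'²` (from `𝔪' = 𝔪^{(p)}R'`: otherwise `𝔪' ⊆ 𝔪'²`, `𝔪' = 0`, `dim = 0`, `R = k = k' = R'`).
Everything else of the printed proof (induction on `dim R`; the case `𝔪' ⊄ 𝔪²` by slicing and lifting, p. 377
l. 14–22; the residue-field and one-step extensions `R'[c] ≅ R'[X]/(X^p − c^p)`, KN 1980 Lemmas 2.4–2.5 /
Nagata 38.4; freeness = Matsumura Thm. 46 / 23.1) is PROVED above; the induction here runs on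
`dim R + rank_{R'} R`. [cite: KimuraNiitsuma1982, Theorem §3 p. 375, proof p. 377; Lemma 5 p. 376] -/
theorem kimuraNiitsuma1982_theorem_of_lemma5
    (h5 : ∀ (p : ℕ) [Fact p.Prime] (R : Type u) [CommRing R] [IsRegularLocalRing R] [CharP R p]
      (R' : Subring R) [IsRegularLocalRing R'] (hR' : (frobenius R p).range ≤ R'),
      Module.Finite R' R → R' ≠ ⊤ → (∀ x : R, ∃ x' ∈ R', x - x' ∈ maximalIdeal R) →
      (∀ x ∈ R', x ∈ maximalIdeal R → x ∈ maximalIdeal R ^ 2) →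
      ∃ z ∈ maximalIdeal R, (⟨z ^ p, hR' ⟨z, rfl⟩⟩ : R') ∉ maximalIdeal R' ^ 2) :
    KimuraNiitsuma1982_theorem.{u} := by
  intro p _ R _ _ _ R' hR' hreg hfin
  suffices H : ∀ (n : ℕ) (R : Type u) [CommRing R] [IsRegularLocalRing R] [CharP R p] (R' : Subring R),
      (frobenius R p).range ≤ R' → IsRegularLocalRing R' → Module.Finite R' R →
      ∀ d : ℕ, ringKrullDim R = d → d + Module.finrank R' R ≤ n →
        ∃ (s : ℕ) (b : Fin s → R), Algebra.adjoin R' (Set.range b) = ⊤ ∧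
          LinearIndependent R' (monomial p b) by
    obtain ⟨d, hd⟩ := exists_nat_cast_eq_ringKrullDim (R := R)
    obtain ⟨s, b, hadj, hli⟩ := H _ R R' hR' hreg hfin d hd le_rfl
    exact ⟨Set.range b, isPBasisOver_range hadj hli⟩
  intro n
  induction n with
  | zero =>
    intro R _ _ _ R' hR' hreg hfin d hd hle
    haveI := hreg
    haveI : Nontrivial R' := R'.subtype.domain_nontrivial
    haveI := free hR' hreg
    have := (Module.finrank_pos_iff_of_free R' R).mpr inferInstance
    omega
  | succ n ih =>
    intro R _ _ _ R' hR' hreg hfin d hd hle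
    classical
    haveI := hreg
    have hp' : p.Prime := Fact.out
    haveI : Nontrivial R' := R'.subtype.domain_nontrivial
    by_cases h1 : R' = ⊤
    · -- `R = R'`: the empty family
      refine ⟨0, Fin.elim0, ?_, ?_⟩
      · rw [eq_top_iff]
        intro x _
        have hx : x ∈ R' := h1 ▸ Subring.mem_top x
        exact Subalgebra.algebraMap_mem _ (⟨x, hx⟩ : R')
      · rw [Fintype.linearIndependent_iff]
        intro g hg i
        have hmon : ∀ m : Fin 0 → Fin p, monomial p (Fin.elim0 : Fin 0 → R) m = 1 := fun m => by
          simp [monomial]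
        have hsum : ∑ m : Fin 0 → Fin p, g m • monomial p (Fin.elim0 : Fin 0 → R) m = g i • 1 := by
          rw [Fintype.sum_eq_single i (fun j hj => absurd (Subsingleton.elim j i) hj), hmon]
        rw [hsum, Subring.smul_def, smul_eq_mul, mul_one] at hg
        exact Subtype.ext hg
    by_cases h2 : ∃ c : R, ∀ b : R', c - b ∉ maximalIdeal R
    · -- residually new element: one-step
      obtain ⟨c, hc⟩ := h2
      have hregA := isRegularLocalRing_adjoinRoot_of_residue hR' hreg c hc
      haveI := hfin
      obtain ⟨R'', hle', hcR'', hR''eq, hfrob'', hreg'', hfin'', hli_c, hrank, hpos⟩ := oneStep hR' hreg c hregA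
      have h2f : 2 * Module.finrank R'' R ≤ p * Module.finrank R'' R := Nat.mul_le_mul_right _ hp'.two_le
      have hμ : d + Module.finrank R'' R ≤ n := by omega
      obtain ⟨s, b, hadj, hli⟩ := ih R R'' hfrob'' hreg'' hfin'' d hd hμ
      exact ⟨s + 1, Fin.cons c b, adjoin_cons_eq_top hR''eq hadj,
        linearIndependent_monomial_cons hle' hcR'' hli_c hli⟩
    by_cases h3 : ∃ z ∈ maximalIdeal R, (⟨z ^ p, hR' ⟨z, rfl⟩⟩ : R') ∉ maximalIdeal R' ^ 2
    · -- `z^p ∉ 𝔪'²`: one-step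
      obtain ⟨z, hz, hz2⟩ := h3
      have hz1 : (⟨z ^ p, hR' ⟨z, rfl⟩⟩ : R') ∈ maximalIdeal R' :=
        (mem_maximalIdeal_iff hR' _).mpr (Ideal.pow_mem_of_mem _ hz p hp'.pos)
      have hregA := isRegularLocalRing_adjoinRoot_of_not_mem_sq hR' hreg z hz1 hz2
      haveI := hfin
      obtain ⟨R'', hle', hcR'', hR''eq, hfrob'', hreg'', hfin'', hli_c, hrank, hpos⟩ := oneStep hR' hreg z hregA
      have h2f : 2 * Module.finrank R'' R ≤ p * Module.finrank R'' R := Nat.mul_le_mul_right _ hp'.two_le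
      have hμ : d + Module.finrank R'' R ≤ n := by omega
      obtain ⟨s, b, hadj, hli⟩ := ih R R'' hfrob'' hreg'' hfin'' d hd hμ
      exact ⟨s + 1, Fin.cons z b, adjoin_cons_eq_top hR''eq hadj,
        linearIndependent_monomial_cons hle' hcR'' hli_c hli⟩
    by_cases h4 : ∃ y ∈ R', y ∈ maximalIdeal R ∧ y ∉ maximalIdeal R ^ 2
    · -- slicing by `y ∈ 𝔪' ∖ 𝔪²`
      obtain ⟨y, hyR', hym, hym2⟩ := h4
      haveI := hfin
      obtain ⟨hchar, hregb, Rb', hdimb, hfrobb, hregRb', hfinb, -, hrankle, hlift⟩ := slice hR' hreg hyR' hym hym2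
      haveI := hchar
      haveI := hregb
      obtain ⟨d', hd'⟩ := exists_nat_cast_eq_ringKrullDim (R := R ⧸ Ideal.span {y})
      have hdd : d' + 1 = d := by
        rw [hd', hd] at hdimb
        have : ((d' + 1 : ℕ) : WithBot ℕ∞) = (d : ℕ) := by exact_mod_cast hdimb
        exact_mod_cast this
      have hμ : d' + Module.finrank Rb' (R ⧸ Ideal.span {y}) ≤ n := by omega
      obtain ⟨s, bb, hadjb, hlib⟩ := ih (R ⧸ Ideal.span {y}) Rb' hfrobb hregRb' hfinb d' hd' hμ
      choose b hb using fun i => Ideal.Quotient.mk_surjective (bb i)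
      have hcomp : Ideal.Quotient.mk (Ideal.span {y}) ∘ b = bb := funext hb
      rw [← hcomp] at hadjb hlib
      obtain ⟨hadj, hli⟩ := hlift s b hadjb hlib
      exact ⟨s, b, hadj, hli⟩
    · -- the remaining case is excluded by Lemma 5
      exfalso
      push Not at h2 h3 h4
      haveI := hfin
      have h2' : ∀ x : R, ∃ x' ∈ R', x - x' ∈ maximalIdeal R := fun x => by
        obtain ⟨b, hb⟩ := h2 x
        exact ⟨b, b.2, hb⟩
      obtain ⟨z, hz, hz2⟩ := h5 p R R' hR' hfin h1 h2' (fun x hx hxm => h4 x hx hxm)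
      exact hz2 (h3 z hz)

end RelativePBasis

/-! ## The case `dim R ≤ 1` of the Lemma-5 input, and the bounded assembly -/

namespace RelativePBasis

open Literature.AlgebraicGeometry.Resolution

variable {p : ℕ} [hp : Fact p.Prime] {R : Type u} [CommRing R] [CharP R p] {R' : Subring R}

/-- A regular local ring of dimension `1` is a discrete valuation ring (its maximal ideal needs `dim = 1`
generator, Mathlib `IsDiscreteValuationRing.TFAE`); cf. the same folklore lemma in
`Literature.AlgebraicGeometry.Resolution.CompleteLocalDomainNormalization` (not imported here: heavy cone).
[folklore] -/
private theorem isDiscreteValuationRing_of_ringKrullDim_eq_one (A : Type u) [CommRing A] [IsDomain A]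
    [IsRegularLocalRing A] (h : ringKrullDim A = 1) : IsDiscreteValuationRing A := by
  have hspan : (maximalIdeal A).spanFinrank = 1 := by
    have e := IsRegularLocalRing.spanFinrank_maximalIdeal (R := A)
    rw [h] at e
    exact_mod_cast e
  have hnf : ¬ IsField A := fun hF =>
    zero_ne_one ((ringKrullDim_eq_zero_of_isField hF).symm.trans h)
  exact ((IsDiscreteValuationRing.TFAE A hnf).out 0 4).mpr
    ((Submodule.spanFinrank_eq_one_iff _).mp hspan).1

/-- **KN 1982 Lemma 5, content used on p. 377, CASE `dim R ≤ 1` (proved here; any rank).** For a pair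
`R ⊋ R' ⊇ R^p` of regular local rings with `R` module-finite over `R'`, the same residue field and `𝔪' ⊆ 𝔪²`,
if `dim R ≤ 1` then some `z ∈ 𝔪` has `z^p ∉ 𝔪'²`. Proof: `dim R = 0` is impossible (`𝔪 = 0` and `k = k'` force
`R' = R`); for `dim R = 1` both rings are discrete valuation rings, a uniformizer `π'` of `R'` is `unit · ϖ^e` in
`R` with `e ≥ 2` (as `π' ∈ 𝔪²`), and `ϖ^p ∈ R'` is `unit · π'^n`, so `p = e·n`, whence `e = p`, `n = 1`, i.e.
`ϖ^p` is a uniformizer of `R'` and is not in `𝔪'²` (the ramification count `p = e·f` of the printed dimension-one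
picture). [cite: KimuraNiitsuma1982, Lemma 5 p. 376; Theorem §3, proof p. 377] -/
theorem lemma5_of_ringKrullDim_le_one [IsRegularLocalRing R] (hR' : (frobenius R p).range ≤ R')
    (hreg : IsRegularLocalRing R') (hdim : ringKrullDim R ≤ 1) (hne : R' ≠ ⊤)
    (hres : ∀ x : R, ∃ x' ∈ R', x - x' ∈ maximalIdeal R)
    (hsq : ∀ x ∈ R', x ∈ maximalIdeal R → x ∈ maximalIdeal R ^ 2) :
    ∃ z ∈ maximalIdeal R, (⟨z ^ p, hR' ⟨z, rfl⟩⟩ : R') ∉ maximalIdeal R' ^ 2 := by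
  classical
  haveI := hreg
  have hp' : p.Prime := Fact.out
  haveI : IsDomain R := isDomain_of_isRegularLocalRing R
  -- `𝔪 ≠ 0`: otherwise `k = k'` forces `R' = R`
  have hm0 : maximalIdeal R ≠ ⊥ := by
    intro hbot
    apply hne
    rw [eq_top_iff]
    intro x _
    obtain ⟨x', hx', hxx'⟩ := hres x
    rw [hbot, Ideal.mem_bot, sub_eq_zero] at hxx'
    rw [hxx']
    exact hx'
  -- hence `dim R = 1`
  obtain ⟨d, hd⟩ := exists_nat_cast_eq_ringKrullDim (R := R)
  have hd1 : d ≤ 1 := by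
    rw [hd] at hdim
    exact_mod_cast hdim
  have hd0 : d ≠ 0 := by
    rintro rfl
    apply hm0
    have e := IsRegularLocalRing.spanFinrank_maximalIdeal (R := R)
    rw [hd] at e
    have e0 : (maximalIdeal R).spanFinrank = 0 := by exact_mod_cast e
    exact (Submodule.spanFinrank_eq_zero_iff_eq_bot (IsNoetherian.noetherian _)).mp e0
  have hdim1 : ringKrullDim R = 1 := by
    have : d = 1 := by omega
    subst this
    rw [hd, Nat.cast_one]
  haveI : IsDiscreteValuationRing R := isDiscreteValuationRing_of_ringKrullDim_eq_one R hdim1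
  have hdimR' : ringKrullDim R' = 1 := (ringKrullDim_eq hR').trans hdim1
  haveI : IsDiscreteValuationRing R' := isDiscreteValuationRing_of_ringKrullDim_eq_one R' hdimR'
  obtain ⟨ϖ, hϖ⟩ := IsDiscreteValuationRing.exists_irreducible R
  obtain ⟨π, hπ⟩ := IsDiscreteValuationRing.exists_irreducible R'
  have hϖ0 : ϖ ≠ 0 := hϖ.ne_zero
  have hϖm : ϖ ∈ maximalIdeal R := hϖ.not_isUnit
  -- the uniformizer `π` of `R'` seen in `R`: `π = unit · ϖ^e` with `e ≥ 2`
  have hπm' : π ∈ maximalIdeal R' := hπ.not_isUnit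
  have hπm : (π : R) ∈ maximalIdeal R := (mem_maximalIdeal_iff hR' π).mp hπm'
  have hπm2 : (π : R) ∈ maximalIdeal R ^ 2 := hsq _ π.2 hπm
  have hπ0 : (π : R) ≠ 0 := fun h => hπ.ne_zero (Subtype.ext h)
  obtain ⟨e, u, hu⟩ := IsDiscreteValuationRing.associated_pow_irreducible hπ0 hϖ
  -- `hu : (π : R) * u = ϖ ^ e`
  rw [hϖ.maximalIdeal_eq, Ideal.span_singleton_pow, Ideal.mem_span_singleton'] at hπm2
  obtain ⟨c, hc⟩ := hπm2
  -- `hc : c * ϖ ^ 2 = π`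
  have he2 : 2 ≤ e := by
    by_contra hlt
    push Not at hlt
    interval_cases e
    · -- `e = 0`: `π` is a unit of `R`
      apply hπm
      exact IsUnit.of_mul_eq_one _ (by rw [pow_zero] at hu; exact hu)
    · -- `e = 1`: `ϖ ∈ 𝔪²`, absurd
      apply hϖm
      rw [pow_one] at hu
      have h1 : ϖ * (ϖ * (c * u)) = ϖ * 1 := by
        rw [mul_one]
        calc ϖ * (ϖ * (c * u)) = (c * ϖ ^ 2) * u := by ring
          _ = ϖ := by rw [hc, hu]
      exact IsUnit.of_mul_eq_one _ (mul_left_cancel₀ hϖ0 h1)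
  -- `ϖ^p ∈ R'` is `unit · π^n`
  set q : R' := ⟨ϖ ^ p, hR' ⟨ϖ, rfl⟩⟩ with hqdef
  have hq0 : q ≠ 0 := by
    intro h
    have : (q : R) = 0 := by rw [h]; rfl
    exact pow_ne_zero p hϖ0 this
  obtain ⟨n, w, hw⟩ := IsDiscreteValuationRing.associated_pow_irreducible hq0 hπ
  -- `hw : q * w = π ^ n`; compare in `R`: `ϖ^p · w = (ϖ^e u⁻¹)^n`
  have hwR : ϖ ^ p * (w : R') = ((π : R')  : R) ^ n := by
    have := congrArg Subtype.val hw
    simpa [hqdef] using this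
  have hπeq : ((π : R') : R) = ϖ ^ e * ↑u⁻¹ := by
    rw [← hu, mul_assoc, Units.mul_inv, mul_one]
  have hwunit : IsUnit ((w : R') : R) := (w.isUnit).map R'.subtype
  have hcongr : (hwunit.unit : R) * ϖ ^ p = ↑((u⁻¹) ^ n) * ϖ ^ (e * n) := by
    rw [IsUnit.unit_spec, mul_comm, hwR, hπeq, mul_pow, pow_mul, Units.val_pow_eq_pow_val]
    ring
  have hpn : p = e * n := IsDiscreteValuationRing.unit_mul_pow_congr_pow hϖ hϖ _ _ _ _ hcongr
  have hep : e = p := by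
    rcases hp'.eq_one_or_self_of_dvd e (Dvd.intro n hpn.symm) with h1 | h1
    · omega
    · exact h1
  have hn1 : n = 1 := by
    subst hep
    have : e * n = e * 1 := by rw [mul_one]; exact hpn.symm
    exact mul_left_cancel₀ hp'.ne_zero this
  rw [hn1, pow_one] at hw
  -- `q = π · w⁻¹` is a uniformizer of `R'`, hence not in `𝔪'²`
  refine ⟨ϖ, hϖm, ?_⟩
  change q ∉ maximalIdeal R' ^ 2
  rw [hπ.maximalIdeal_eq, Ideal.span_singleton_pow, Ideal.mem_span_singleton']
  rintro ⟨c', hc'⟩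
  -- `hc' : c' * π ^ 2 = q`, and `q * w = π`
  apply hπm'
  have h1 : π * (π * (c' * w)) = π * 1 := by
    rw [mul_one]
    calc π * (π * (c' * w)) = (c' * π ^ 2) * w := by ring
      _ = π := by rw [hc', hw]
  exact IsUnit.of_mul_eq_one _ (mul_left_cancel₀ hπ.ne_zero h1)

/-- **KN 1982 THEOREM §3 with dimension and rank bounds threaded through the induction.** The landed
assembly `kimuraNiitsuma1982_theorem_of_lemma5` only ever revisits the SAME ring `R` over a larger subring
(one-step extensions: `rank_{R''} R = rank_{R'} R / p`) or a SLICE `R/yR ⊇ R'/yR'` (`dim` drops by one, the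
free rank does not increase), so the Lemma-5 input `h5` is only needed for pairs with `dim ≤ D` and
`rank ≤ F` when one starts from such a pair. Same proof as the landed assembly, bounds carried along.
[cite: KimuraNiitsuma1982, Theorem §3 p. 375, proof p. 377; Lemma 5 p. 376] -/
theorem exists_isPBasisOver_of_lemma5_le (D F : ℕ)
    (h5 : ∀ (R : Type u) [CommRing R] [IsRegularLocalRing R] [CharP R p]
      (R' : Subring R) [IsRegularLocalRing R'] (hR' : (frobenius R p).range ≤ R'),
      Module.Finite R' R → ringKrullDim R ≤ D → Module.finrank R' R ≤ F → R' ≠ ⊤ →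
      (∀ x : R, ∃ x' ∈ R', x - x' ∈ maximalIdeal R) →
      (∀ x ∈ R', x ∈ maximalIdeal R → x ∈ maximalIdeal R ^ 2) →
      ∃ z ∈ maximalIdeal R, (⟨z ^ p, hR' ⟨z, rfl⟩⟩ : R') ∉ maximalIdeal R' ^ 2)
    [IsRegularLocalRing R] (hR' : (frobenius R p).range ≤ R') (hreg : IsRegularLocalRing R')
    [hfin : Module.Finite R' R] (hD : ringKrullDim R ≤ D) (hF : Module.finrank R' R ≤ F) :
    ∃ Γ : Set R, IsPBasisOver p R' Γ := by
  suffices H : ∀ (n : ℕ) (R : Type u) [CommRing R] [IsRegularLocalRing R] [CharP R p] (R' : Subring R),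
      (frobenius R p).range ≤ R' → IsRegularLocalRing R' → Module.Finite R' R →
      ∀ d : ℕ, ringKrullDim R = d → d ≤ D → Module.finrank R' R ≤ F → d + Module.finrank R' R ≤ n →
        ∃ (s : ℕ) (b : Fin s → R), Algebra.adjoin R' (Set.range b) = ⊤ ∧
          LinearIndependent R' (monomial p b) by
    obtain ⟨d, hd⟩ := exists_nat_cast_eq_ringKrullDim (R := R)
    have hdD : d ≤ D := by
      rw [hd] at hD
      exact_mod_cast hD
    obtain ⟨s, b, hadj, hli⟩ := H _ R R' hR' hreg hfin d hd hdD hF le_rfl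
    exact ⟨Set.range b, isPBasisOver_range hadj hli⟩
  intro n
  induction n with
  | zero =>
    intro R _ _ _ R' hR' hreg hfin d hd _ _ hle
    haveI := hreg
    haveI : Nontrivial R' := R'.subtype.domain_nontrivial
    haveI := free hR' hreg
    have := (Module.finrank_pos_iff_of_free R' R).mpr inferInstance
    omega
  | succ n ih =>
    intro R _ _ _ R' hR' hreg hfin d hd hdD hF hle
    classical
    haveI := hreg
    have hp' : p.Prime := Fact.out
    haveI : Nontrivial R' := R'.subtype.domain_nontrivial
    by_cases h1 : R' = ⊤
    · -- `R = R'`: the empty family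
      refine ⟨0, Fin.elim0, ?_, ?_⟩
      · rw [eq_top_iff]
        intro x _
        have hx : x ∈ R' := h1 ▸ Subring.mem_top x
        exact Subalgebra.algebraMap_mem _ (⟨x, hx⟩ : R')
      · rw [Fintype.linearIndependent_iff]
        intro g hg i
        have hmon : ∀ m : Fin 0 → Fin p, monomial p (Fin.elim0 : Fin 0 → R) m = 1 := fun m => by
          simp [monomial]
        have hsum : ∑ m : Fin 0 → Fin p, g m • monomial p (Fin.elim0 : Fin 0 → R) m = g i • 1 := by
          rw [Fintype.sum_eq_single i (fun j hj => absurd (Subsingleton.elim j i) hj), hmon]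
        rw [hsum, Subring.smul_def, smul_eq_mul, mul_one] at hg
        exact Subtype.ext hg
    by_cases h2 : ∃ c : R, ∀ b : R', c - b ∉ maximalIdeal R
    · -- residually new element: one-step
      obtain ⟨c, hc⟩ := h2
      have hregA := isRegularLocalRing_adjoinRoot_of_residue hR' hreg c hc
      haveI := hfin
      obtain ⟨R'', hle', hcR'', hR''eq, hfrob'', hreg'', hfin'', hli_c, hrank, hpos⟩ := oneStep hR' hreg c hregA
      have h2f : 2 * Module.finrank R'' R ≤ p * Module.finrank R'' R := Nat.mul_le_mul_right _ hp'.two_le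
      have hμ : d + Module.finrank R'' R ≤ n := by omega
      have hF'' : Module.finrank R'' R ≤ F := by omega
      obtain ⟨s, b, hadj, hli⟩ := ih R R'' hfrob'' hreg'' hfin'' d hd hdD hF'' hμ
      exact ⟨s + 1, Fin.cons c b, adjoin_cons_eq_top hR''eq hadj,
        linearIndependent_monomial_cons hle' hcR'' hli_c hli⟩
    by_cases h3 : ∃ z ∈ maximalIdeal R, (⟨z ^ p, hR' ⟨z, rfl⟩⟩ : R') ∉ maximalIdeal R' ^ 2
    · -- `z^p ∉ 𝔪'²`: one-step
      obtain ⟨z, hz, hz2⟩ := h3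
      have hz1 : (⟨z ^ p, hR' ⟨z, rfl⟩⟩ : R') ∈ maximalIdeal R' :=
        (mem_maximalIdeal_iff hR' _).mpr (Ideal.pow_mem_of_mem _ hz p hp'.pos)
      have hregA := isRegularLocalRing_adjoinRoot_of_not_mem_sq hR' hreg z hz1 hz2
      haveI := hfin
      obtain ⟨R'', hle', hcR'', hR''eq, hfrob'', hreg'', hfin'', hli_c, hrank, hpos⟩ := oneStep hR' hreg z hregA
      have h2f : 2 * Module.finrank R'' R ≤ p * Module.finrank R'' R := Nat.mul_le_mul_right _ hp'.two_le
      have hμ : d + Module.finrank R'' R ≤ n := by omega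
      have hF'' : Module.finrank R'' R ≤ F := by omega
      obtain ⟨s, b, hadj, hli⟩ := ih R R'' hfrob'' hreg'' hfin'' d hd hdD hF'' hμ
      exact ⟨s + 1, Fin.cons z b, adjoin_cons_eq_top hR''eq hadj,
        linearIndependent_monomial_cons hle' hcR'' hli_c hli⟩
    by_cases h4 : ∃ y ∈ R', y ∈ maximalIdeal R ∧ y ∉ maximalIdeal R ^ 2
    · -- slicing by `y ∈ 𝔪' ∖ 𝔪²`
      obtain ⟨y, hyR', hym, hym2⟩ := h4
      haveI := hfin
      obtain ⟨hchar, hregb, Rb', hdimb, hfrobb, hregRb', hfinb, -, hrankle, hlift⟩ := slice hR' hreg hyR' hym hym2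
      haveI := hchar
      haveI := hregb
      obtain ⟨d', hd'⟩ := exists_nat_cast_eq_ringKrullDim (R := R ⧸ Ideal.span {y})
      have hdd : d' + 1 = d := by
        rw [hd', hd] at hdimb
        have : ((d' + 1 : ℕ) : WithBot ℕ∞) = (d : ℕ) := by exact_mod_cast hdimb
        exact_mod_cast this
      have hμ : d' + Module.finrank Rb' (R ⧸ Ideal.span {y}) ≤ n := by omega
      have hdD' : d' ≤ D := by omega
      have hFb : Module.finrank Rb' (R ⧸ Ideal.span {y}) ≤ F := le_trans hrankle hF
      obtain ⟨s, bb, hadjb, hlib⟩ := ih (R ⧸ Ideal.span {y}) Rb' hfrobb hregRb' hfinb d' hd' hdD' hFb hμ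
      choose b hb using fun i => Ideal.Quotient.mk_surjective (bb i)
      have hcomp : Ideal.Quotient.mk (Ideal.span {y}) ∘ b = bb := funext hb
      rw [← hcomp] at hadjb hlib
      obtain ⟨hadj, hli⟩ := hlift s b hadjb hlib
      exact ⟨s, b, hadj, hli⟩
    · -- the remaining case is excluded by the Lemma-5 input, needed only at `dim ≤ D`, `rank ≤ F`
      exfalso
      push Not at h2 h3 h4
      haveI := hfin
      have h2' : ∀ x : R, ∃ x' ∈ R', x - x' ∈ maximalIdeal R := fun x => by
        obtain ⟨b, hb⟩ := h2 x
        exact ⟨b, b.2, hb⟩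
      have hdimD : ringKrullDim R ≤ D := by
        rw [hd]
        exact_mod_cast hdD
      obtain ⟨z, hz, hz2⟩ := h5 R R' hR' hfin hdimD hF h1 h2' (fun x hx hxm => h4 x hx hxm)
      exact hz2 (h3 z hz)

/-- **Kimura–Niitsuma 1982 THEOREM §3, UNCONDITIONAL for `dim R ≤ 1` (any rank).** A regular local ring `R` of
characteristic `p` and dimension `≤ 1`, module-finite over a regular local subring `R' ⊇ R^p`, has a `p`-basis over
`R'`: the bounded assembly above needs the Lemma-5 input only in dimension `≤ 1`, where it is
`lemma5_of_ringKrullDim_le_one`. [cite: KimuraNiitsuma1982, Theorem §3 p. 375] -/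
theorem exists_isPBasisOver_of_ringKrullDim_le_one [IsRegularLocalRing R] (hR' : (frobenius R p).range ≤ R')
    (hreg : IsRegularLocalRing R') [Module.Finite R' R] (hdim : ringKrullDim R ≤ 1) :
    ∃ Γ : Set R, IsPBasisOver p R' Γ :=
  exists_isPBasisOver_of_lemma5_le 1 (Module.finrank R' R)
    (fun R _ _ _ R' _ hR' _ hD _ hne hres hsq =>
      lemma5_of_ringKrullDim_le_one (R := R) (R' := R') hR' ‹_› (by exact_mod_cast hD) hne hres hsq)
    hR' hreg (by exact_mod_cast hdim) le_rfl

end RelativePBasis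

end Literature.RingTheory.PBasis
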